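import Summits.CriticalPhenomena.PercolationContinuityZ3.Theorems.PercNearOneGluingNoHeavyLowerTailCILCutObserverSteiner
import Summits.CriticalPhenomena.PercolationContinuityZ3.Theorems.PercNearOneGluingNoHeavyLowerTailXZDeficiency
import Summits.CriticalPhenomena.PercolationContinuityZ3.Theorems.PercNearOneGluingNoHeavyLowerTailCILTwoGate
import HarnessLib

/-!
# `NoHeavyLowerTail` (stmt-CriticalPhenomena-4575) — CIL for HULL TREES with free leaves

Support file (prover `prim-hp-5`, technique "blob-quotient induction"; `--supports
stmt-CriticalPhenomena-4575`).  No definitions, no named facts, no sorries.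

`μ = prodBernoulli w` on `Fin n`, relays `A ≠ ∅`, observer `o ∉ A`, level `j`; `Γ` = positive pairs, `Γ₀` = its
restriction to non-relays, HULL of `o` = the vertices `Γ₀`-joined to `o`.  A hull vertex is INTERNAL if it is `o`
with a non-relay neighbour, or has two distinct non-relay neighbours; the other hull vertices are LEAVES (all their
neighbours but the parent are relays).

**Theorem (`CutObserver.SteinerPorts.tform_hullTree`, `cumulativeIsolation_hullTree`).**  If every positive pair
at every INTERNAL hull vertex is a bridge of `Γ` — leaves unrestricted: their relay ports may be joined below in
any way, and so may everything below the relay ports of internal vertices — then some relay `c` satisfies the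
T-form `μ{1 ≤ N ≤ j} ≤ μ{1 ≤ N ∧ |π(c)| ≤ j}`, hence the conclusion of `stub_cumulativeIsolation`.
Internal vertices: single-pair branches glued by `CutObserver.SteinerPorts.tform_transfer`; leaves: relay-neighboured
observers inside their class, discharged by `Theorems.attachedChampion_of_relayPorts_dominated` (T-form under port
domination) transported by `CutObserver.TwoGate.measureReal_preimage_off`.  Strictly contains `…CILSeparatedHull`
(all hull pairs bridges), hence all forests; `∃ a, μ{1 ≤ N ≤ j} ≤ μ{|π(a)| ≤ j}` follows by monotonicity.
-/

noncomputable section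

namespace Summit.CriticalPhenomena.PercolationContinuityZ3.Theorems

open MeasureTheory Set Literature.Probability.LatticeModels Literature.Probability.Percolation
open scoped Classical BigOperators

variable {n : ℕ}

namespace CutObserver

namespace SteinerPorts

/-! ### Hull trees: separated INTERNAL hull vertices, arbitrary LEAVES -/

section HullTree

variable (w : Sym2 (Fin n) → unitInterval) (A : Finset (Fin n)) (j : ℕ) (o₀ : Fin n)

/-- **Induction over a hull tree with free leaves.**  Under the bridge hypothesis at INTERNAL hull vertices,
inside every vertex set `U`, at every hull vertex `o ∈ U` (with bridges at `o` if `o` has a non-relay neighbour in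
`U ∖ o`) seeing a relay in `U`, some relay `c ∈ U` satisfies the T-form read inside `U`; leaves (all neighbours
of `o` in `U` relays) by the transported relay-neighbour T-form, internal vertices by `tform_transfer` over the
classes of `U ∖ o`, strong induction on `|U|`. [folklore] -/
theorem tform_hullTree_inside
    (hH : ∀ v u : Fin n,
      (SimpleGraph.fromRel fun x y : Fin n => x ∉ A ∧ y ∉ A ∧ w s(x, y) ≠ 0).Reachable o₀ v →
      ((v = o₀ ∧ ∃ u', u' ∉ A ∧ (SimpleGraph.fromRel fun x y : Fin n => w s(x, y) ≠ 0).Adj v u') ∨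
        (∃ u₁ u₂, u₁ ≠ u₂ ∧ u₁ ∉ A ∧ u₂ ∉ A ∧
          (SimpleGraph.fromRel fun x y : Fin n => w s(x, y) ≠ 0).Adj v u₁ ∧
          (SimpleGraph.fromRel fun x y : Fin n => w s(x, y) ≠ 0).Adj v u₂)) →
      (SimpleGraph.fromRel fun x y : Fin n => w s(x, y) ≠ 0).Adj v u →
      (SimpleGraph.fromRel fun x y : Fin n => w s(x, y) ≠ 0).IsBridge s(v, u)) :
    ∀ (m : ℕ) (U : Finset (Fin n)), U.card = m → ∀ o ∈ U, o ∉ A →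
      (SimpleGraph.fromRel fun x y : Fin n => x ∉ A ∧ y ∉ A ∧ w s(x, y) ≠ 0).Reachable o₀ o →
      ((∃ u ∈ U, u ∉ A ∧ u ≠ o ∧ w s(o, u) ≠ 0) → ∀ u,
        (SimpleGraph.fromRel fun x y : Fin n => w s(x, y) ≠ 0).Adj o u →
        (SimpleGraph.fromRel fun x y : Fin n => w s(x, y) ≠ 0).IsBridge s(o, u)) →
      (∃ x ∈ U, x ∈ A) →
      ∃ c ∈ U, c ∈ A ∧
        (prodBernoulli w).real {ω : BondConfig (Fin n) |
            1 ≤ (A.filter fun x => (openGraph (ω ∩ ↑(U.sym2))).Reachable o x).card ∧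
              (A.filter fun x => (openGraph (ω ∩ ↑(U.sym2))).Reachable o x).card ≤ j} ≤
          (prodBernoulli w).real {ω : BondConfig (Fin n) |
            1 ≤ (A.filter fun x => (openGraph (ω ∩ ↑(U.sym2))).Reachable o x).card ∧
              (A.filter fun x => (openGraph (ω ∩ ↑(U.sym2))).Reachable c x).card ≤ j} := by
  set Γ : SimpleGraph (Fin n) := SimpleGraph.fromRel fun x y : Fin n => w s(x, y) ≠ 0 with hΓ
  set Γ₀ : SimpleGraph (Fin n) :=
    SimpleGraph.fromRel fun x y : Fin n => x ∉ A ∧ y ∉ A ∧ w s(x, y) ≠ 0 with hΓ₀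
  intro m
  induction m using Nat.strong_induction_on with
  | _ m IH =>
  intro U hUm o hoU hoA hhull hbrO hxA
  have hΓadj : ∀ x y, Γ.Adj x y ↔ x ≠ y ∧ w s(x, y) ≠ 0 := by
    intro x y
    rw [hΓ, SimpleGraph.fromRel_adj]
    constructor
    · rintro ⟨hne, h | h⟩
      · exact ⟨hne, h⟩
      · exact ⟨hne, by rw [Sym2.eq_swap]; exact h⟩
    · rintro ⟨hne, h⟩
      exact ⟨hne, Or.inl h⟩
  by_cases hleaf : ¬ ∃ u ∈ U, u ∉ A ∧ u ≠ o ∧ w s(o, u) ≠ 0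
  · push Not at hleaf  -- LEAF: every positive neighbour of `o` in `U` is a relay: RN theorem, transported
    set D : Set (Sym2 (Fin n)) := ↑(U.sym2) with hD
    set w' : Sym2 (Fin n) → unitInterval := fun e => if e ∈ D then w e else 0 with hw'
    have hw'ne : ∀ y, w' s(o, y) ≠ 0 → y ∈ U ∧ w s(o, y) ≠ 0 := by
      intro y hy
      simp only [hw'] at hy
      split_ifs at hy with hmem
      · rw [hD, Finset.mem_coe, Finset.mk_mem_sym2_iff] at hmem
        exact ⟨hmem.2, hy⟩
      · exact absurd rfl hy
    have hports : ∀ y : Fin n, y ≠ o → w' s(o, y) ≠ 0 → y ∈ A := by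
      intro y hyo hy
      obtain ⟨hyU, hwy⟩ := hw'ne y hy
      by_contra hyA
      exact hwy (hleaf y hyU hyA hyo)
    have htr : ∀ T : Set (BondConfig (Fin n)),
        (prodBernoulli w).real {ω : BondConfig (Fin n) | ω ∩ D ∈ T} = (prodBernoulli w').real T :=
      fun T => TwoGate.measureReal_preimage_off w D T
    set P := U.filter (fun y => y ≠ o ∧ w s(o, y) ≠ 0) with hP
    by_cases hPne : P.Nonempty
    · set sW : Fin n → ℝ := fun y => (prodBernoulli w').real {ω : BondConfig (Fin n) |
        (A.filter fun z => (openGraph (ω ∩ {e | o ∉ e})).Reachable y z).card ≤ j} with hsW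
      obtain ⟨q, hqP, hqmax⟩ := Finset.exists_max_image P sW hPne
      obtain ⟨hqU, hqo, hwq⟩ := Finset.mem_filter.1 hqP
      have hqA : q ∈ A := by
        by_contra hqA
        exact hwq (hleaf q hqU hqA hqo)
      have hdom : ∀ y : Fin n, y ≠ o → w' s(o, y) ≠ 0 → sW y ≤ sW q := by
        intro y hyo hy
        obtain ⟨hyU, hwy⟩ := hw'ne y hy
        exact hqmax y (Finset.mem_filter.2 ⟨hyU, hyo, hwy⟩)
      have hRN := attachedChampion_of_relayPorts_dominated w' A o q j hoA hqo hports hdom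
      refine ⟨q, hqU, hqA, ?_⟩
      have eL : {ω : BondConfig (Fin n) |
          1 ≤ (A.filter fun x => (openGraph (ω ∩ D)).Reachable o x).card ∧
            (A.filter fun x => (openGraph (ω ∩ D)).Reachable o x).card ≤ j} =
          {ω : BondConfig (Fin n) | ω ∩ D ∈ {ξ : BondConfig (Fin n) |
            1 ≤ (A.filter fun x => ξ ∈ openConn o x).card ∧
              (A.filter fun x => ξ ∈ openConn o x).card ≤ j}} := by
        ext ω
        simp only [mem_setOf_eq, TwoGate.mem_openConn_iff']
      have eR : {ω : BondConfig (Fin n) |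
          1 ≤ (A.filter fun x => (openGraph (ω ∩ D)).Reachable o x).card ∧
            (A.filter fun x => (openGraph (ω ∩ D)).Reachable q x).card ≤ j} =
          {ω : BondConfig (Fin n) | ω ∩ D ∈ {ξ : BondConfig (Fin n) |
            (A.filter fun x => ξ ∈ openConn q x).card ≤ j ∧
              1 ≤ (A.filter fun x => ξ ∈ openConn o x).card}} := by
        ext ω
        simp only [mem_setOf_eq, TwoGate.mem_openConn_iff']
        exact and_comm
      rw [eL, eR, htr, htr]
      exact hRN
    · -- no neighbour of `o` inside `U`: `N = 0` inside `U` (almost surely)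
      obtain ⟨x₀, hx₀U, hx₀A⟩ := hxA
      refine ⟨x₀, hx₀U, hx₀A, ?_⟩
      have h0 : ({ω : BondConfig (Fin n) |
          1 ≤ (A.filter fun x => (openGraph (ω ∩ D)).Reachable o x).card ∧
            (A.filter fun x => (openGraph (ω ∩ D)).Reachable o x).card ≤ j} ∩
          {ω | ∀ e ∈ ω, w e ≠ 0}) = ∅ := by
        ext ω
        constructor
        · rintro ⟨⟨h1, -⟩, hG⟩
          exfalso
          obtain ⟨x, hx⟩ := Finset.card_pos.1 h1
          rw [Finset.mem_filter] at hx
          have hxo : x ≠ o := fun h => hoA (h ▸ hx.1)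
          have hcl : ∀ u ∈ ({o} : Set (Fin n)), ∀ v, (openGraph (ω ∩ D)).Adj u v →
              v ∈ ({o} : Set (Fin n)) := by
            intro u hu v huv
            rw [Set.mem_singleton_iff] at hu
            rw [hu, hD, adj_restrict_iff] at huv
            obtain ⟨huvω, -, hvU, hne⟩ := huv
            exact absurd ⟨v, Finset.mem_filter.2 ⟨hvU, hne.symm, hG _ huvω⟩⟩ hPne
          exact hxo (Set.mem_singleton_iff.1 (mem_of_reachable_of_closed _ _ hcl rfl hx.2))
        · exact fun h => False.elim h
      calc (prodBernoulli w).real {ω : BondConfig (Fin n) |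
            1 ≤ (A.filter fun x => (openGraph (ω ∩ D)).Reachable o x).card ∧
              (A.filter fun x => (openGraph (ω ∩ D)).Reachable o x).card ≤ j}
          = (prodBernoulli w).real ({ω : BondConfig (Fin n) |
              1 ≤ (A.filter fun x => (openGraph (ω ∩ D)).Reachable o x).card ∧
                (A.filter fun x => (openGraph (ω ∩ D)).Reachable o x).card ≤ j} ∩
              {ω | ∀ e ∈ ω, w e ≠ 0}) := (measureReal_inter_support w _).symm
        _ = 0 := by rw [h0, measureReal_empty]
        _ ≤ _ := measureReal_nonneg
  push Not at hleaf
  have hbrO' := hbrO hleaf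
  set U' := U.erase o with hU'
  set Γ' : SimpleGraph (Fin n) := SimpleGraph.fromRel fun x y : Fin n => x ∈ U' ∧ y ∈ U' ∧ w s(x, y) ≠ 0
    with hΓ'
  have hΓ'adj : ∀ x y, Γ'.Adj x y ↔ x ≠ y ∧ x ∈ U' ∧ y ∈ U' ∧ w s(x, y) ≠ 0 := by
    intro x y
    rw [hΓ', SimpleGraph.fromRel_adj]
    constructor
    · rintro ⟨hne, h | h⟩
      · exact ⟨hne, h⟩
      · exact ⟨hne, h.2.1, h.1, by rw [Sym2.eq_swap]; exact h.2.2⟩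
    · rintro ⟨hne, h⟩
      exact ⟨hne, Or.inl h⟩
  set comp : Fin n → Finset (Fin n) := fun v => U'.filter fun x => Γ'.Reachable v x with hcomp
  have hmem_comp : ∀ {v x}, x ∈ comp v ↔ x ∈ U' ∧ Γ'.Reachable v x := by
    intro v x; simp only [hcomp, Finset.mem_filter]
  have hself : ∀ {v}, v ∈ U' → v ∈ comp v := fun hv => hmem_comp.2 ⟨hv, SimpleGraph.Reachable.refl _⟩
  have hcomp_eq : ∀ {v x}, x ∈ comp v → comp x = comp v := by
    intro v x hx
    obtain ⟨-, hvx⟩ := hmem_comp.1 hx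
    ext y
    simp only [hmem_comp]
    exact ⟨fun ⟨hy, hxy⟩ => ⟨hy, hvx.trans hxy⟩, fun ⟨hy, hvy⟩ => ⟨hy, hvx.symm.trans hvy⟩⟩
  have hcomp_sub : ∀ v, comp v ⊆ U' := fun v x hx => (hmem_comp.1 hx).1
  have hbridge : ∀ {u₁ u₂}, u₁ ∈ U' → u₂ ∈ U' → w s(o, u₁) ≠ 0 → w s(o, u₂) ≠ 0 → u₁ ≠ u₂ →
      ¬ Γ'.Reachable u₁ u₂ := by
    intro u₁ u₂ hu₁ hu₂ hw₁ hw₂ hne hreach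
    have ho₁ : o ≠ u₁ := fun h => (Finset.mem_erase.1 hu₁).1 h.symm
    have ho₂ : o ≠ u₂ := fun h => (Finset.mem_erase.1 hu₂).1 h.symm
    have hadj₁ : Γ.Adj o u₁ := by rw [hΓ, SimpleGraph.fromRel_adj]; exact ⟨ho₁, Or.inl hw₁⟩
    have hadj₂ : Γ.Adj o u₂ := by rw [hΓ, SimpleGraph.fromRel_adj]; exact ⟨ho₂, Or.inl hw₂⟩
    have hbr := hbrO' u₁ hadj₁
    rw [SimpleGraph.isBridge_iff] at hbr
    apply hbr
    have hle : Γ' ≤ Γ.deleteEdges {s(o, u₁)} := by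
      intro x y hxy
      obtain ⟨hne', hx, hy, hw⟩ := (hΓ'adj x y).1 hxy
      rw [SimpleGraph.deleteEdges_adj]
      refine ⟨by rw [hΓ, SimpleGraph.fromRel_adj]; exact ⟨hne', Or.inl hw⟩, ?_⟩
      rw [Set.mem_singleton_iff, Sym2.eq_iff]
      rintro (⟨rfl, -⟩ | ⟨-, rfl⟩)
      · exact (Finset.mem_erase.1 hx).1 rfl
      · exact (Finset.mem_erase.1 hy).1 rfl
    have h2 : (Γ.deleteEdges {s(o, u₁)}).Adj o u₂ := by
      rw [SimpleGraph.deleteEdges_adj]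
      refine ⟨hadj₂, ?_⟩
      rw [Set.mem_singleton_iff, Sym2.eq_iff]
      rintro (⟨-, h⟩ | ⟨h, -⟩)
      · exact hne h.symm
      · exact ho₁ h
    exact h2.reachable.trans ((hreach.mono hle).symm)
  set 𝒞 := U'.image comp with h𝒞
  set d := 𝒞.card with hd; set e := 𝒞.equivFin with he
  set V : Fin d → Finset (Fin n) := fun l => (e.symm l).1 with hV
  have hVmem : ∀ l, V l ∈ 𝒞 := fun l => (e.symm l).2
  have hVrep : ∀ l, ∃ v ∈ U', V l = comp v := by
    intro l
    obtain ⟨v, hv, hcv⟩ := Finset.mem_image.1 (hVmem l)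
    exact ⟨v, hv, hcv.symm⟩
  have hVsub : ∀ l, V l ⊆ U' := by
    intro l; obtain ⟨v, -, hv⟩ := hVrep l; rw [hv]; exact hcomp_sub v
  have hVcomp : ∀ l, ∀ x ∈ V l, comp x = V l := by
    intro l x hx; obtain ⟨v, -, hv⟩ := hVrep l; rw [hv] at hx ⊢; exact hcomp_eq hx
  have hVinj : ∀ l l', V l = V l' → l = l' := by
    intro l l' h
    have : e.symm l = e.symm l' := Subtype.ext h
    exact e.symm.injective this
  have hdisj : ∀ l l', l ≠ l' → Disjoint (V l) (V l') := by
    intro l l' hll'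
    rw [Finset.disjoint_left]
    intro x hx hx'
    exact hll' (hVinj l l' ((hVcomp l x hx).symm.trans (hVcomp l' x hx')))
  have hcover : ∀ v ∈ U, v ≠ o → ∃ l, v ∈ V l := by
    intro v hv hvo
    have hv' : v ∈ U' := Finset.mem_erase.2 ⟨hvo, hv⟩
    refine ⟨e ⟨comp v, Finset.mem_image.2 ⟨v, hv', rfl⟩⟩, ?_⟩
    simp only [hV, Equiv.symm_apply_apply]
    exact hself hv'
  have hoV : ∀ l, o ∉ V l := fun l h => (Finset.mem_erase.1 (hVsub l h)).1 rfl; have hVW : ∀ l, V l ⊆ U := fun l x hx => (Finset.mem_erase.1 (hVsub l hx)).2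
  have hVne : ∀ l, (V l).Nonempty := by
    intro l; obtain ⟨v, hv, hcv⟩ := hVrep l; exact ⟨v, hcv ▸ hself hv⟩
  have hport : ∀ l, ∃ q ∈ V l, (∀ x ∈ V l, x ≠ q → w s(o, x) = 0) ∧
      ((∃ x ∈ V l, x ∈ A) → q ∉ A → w s(o, q) ≠ 0) := by
    intro l
    by_cases h : ∃ x ∈ V l, w s(o, x) ≠ 0
    · obtain ⟨q, hq, hwq⟩ := h
      refine ⟨q, hq, fun x hx hxq => ?_, fun _ _ => hwq⟩
      by_contra hwx
      refine hbridge (hVsub l hx) (hVsub l hq) hwx hwq hxq ?_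
      have hq' : q ∈ comp x := (hVcomp l x hx).symm ▸ hq
      exact (hmem_comp.1 hq').2
    · push Not at h
      by_cases hA' : ∃ x ∈ V l, x ∈ A
      · obtain ⟨q, hq, hqA⟩ := hA'
        exact ⟨q, hq, fun x hx _ => h x hx, fun _ hqA' => absurd hqA hqA'⟩
      · obtain ⟨q, hq⟩ := hVne l
        exact ⟨q, hq, fun x hx _ => h x hx, fun hl _ => absurd hl hA'⟩
  choose p hpV hobs hpatt using hport
  have hsep : ∀ l l', l ≠ l' → ∀ u ∈ V l, ∀ v ∈ V l', w s(u, v) = 0 := by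
    intro l l' hll' u hu v hv
    by_contra hw
    have huv : u ≠ v := by
      rintro rfl
      exact Finset.disjoint_left.1 (hdisj l l' hll') hu hv
    have hadj : Γ'.Adj u v := (hΓ'adj u v).2 ⟨huv, hVsub l hu, hVsub l' hv, hw⟩
    have hvU : v ∈ comp u := hmem_comp.2 ⟨hVsub l' hv, hadj.reachable⟩
    rw [hVcomp l u hu] at hvU
    exact Finset.disjoint_left.1 (hdisj l l' hll') hvU hv
  have hphull : ∀ l, p l ∉ A → (∃ x ∈ V l, x ∈ A) → Γ₀.Reachable o₀ (p l) := by
    intro l hpl hlive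
    have hw := hpatt l hlive hpl
    refine hhull.trans (SimpleGraph.Adj.reachable ?_)
    rw [hΓ₀, SimpleGraph.fromRel_adj]
    exact ⟨fun h => hoV l (h ▸ hpV l), Or.inl ⟨hoA, hpl, hw⟩⟩
  have hIH : ∀ l, p l ∉ A → (∃ x ∈ V l, x ∈ A) → ∃ c ∈ V l, c ∈ A ∧
      (prodBernoulli w).real {ω : BondConfig (Fin n) |
          1 ≤ (A.filter fun x => (openGraph (ω ∩ ↑((V l).sym2))).Reachable (p l) x).card ∧
            (A.filter fun x => (openGraph (ω ∩ ↑((V l).sym2))).Reachable (p l) x).card ≤ j} ≤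
        (prodBernoulli w).real {ω : BondConfig (Fin n) |
          1 ≤ (A.filter fun x => (openGraph (ω ∩ ↑((V l).sym2))).Reachable (p l) x).card ∧
            (A.filter fun x => (openGraph (ω ∩ ↑((V l).sym2))).Reachable c x).card ≤ j} := by
    intro l hpl hlive
    have hlt : (V l).card < m := by
      rw [← hUm]
      exact Finset.card_lt_card ⟨hVW l, fun h => hoV l (h hoU)⟩
    refine IH (V l).card hlt (V l) rfl (p l) (hpV l) hpl (hphull l hpl hlive) (fun hst v hv => ?_) hlive
    obtain ⟨u, huV, huA, hup, hwu⟩ := hst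
    have hw := hpatt l hlive hpl
    have hop : o ≠ p l := fun h => hoV l (h ▸ hpV l)
    refine hH (p l) v (hphull l hpl hlive) (Or.inr ⟨o, u, ?_, hoA, huA, ?_, ?_⟩) hv
    · rintro rfl; exact hoV l huV
    · exact (hΓadj _ _).2 ⟨hop.symm, by rw [Sym2.eq_swap]; exact hw⟩
    · exact (hΓadj _ _).2 ⟨hup.symm, hwu⟩
  set a : Fin d → Fin n := fun l =>
    if hp : p l ∈ A then p l
    else if hl : (∃ x ∈ V l, x ∈ A) then (hIH l hp hl).choose else p l with ha
  have haV : ∀ l, a l ∈ V l := by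
    intro l
    simp only [ha]
    split_ifs with hp hl
    · exact hpV l
    · exact (hIH l hp hl).choose_spec.1
    · exact hpV l
  have halive : ∀ l, (∃ x ∈ V l, x ∈ A) → a l ∈ A := by
    intro l hl
    simp only [ha]
    split_ifs with hp
    · exact hp
    · exact (hIH l hp hl).choose_spec.2.1
  have hdead : ∀ l, a l ∉ A → ∀ x ∈ V l, x ∉ A := fun l hal x hx hxA => hal (halive l ⟨x, hx, hxA⟩)
  have hT : ∀ l, a l ∈ A →
      (prodBernoulli w).real {ω : BondConfig (Fin n) |
          1 ≤ (A.filter fun x => (openGraph (ω ∩ ↑((V l).sym2))).Reachable (p l) x).card ∧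
            (A.filter fun x => (openGraph (ω ∩ ↑((V l).sym2))).Reachable (p l) x).card ≤ j} ≤
        (prodBernoulli w).real {ω : BondConfig (Fin n) |
          1 ≤ (A.filter fun x => (openGraph (ω ∩ ↑((V l).sym2))).Reachable (p l) x).card ∧
            (A.filter fun x => (openGraph (ω ∩ ↑((V l).sym2))).Reachable (a l) x).card ≤ j} := by
    intro l hal
    by_cases hp : p l ∈ A
    · have : a l = p l := by simp only [ha, dif_pos hp]
      rw [this]
    · have hl : ∃ x ∈ V l, x ∈ A := ⟨a l, haV l, hal⟩
      have : a l = (hIH l hp hl).choose := by simp only [ha, dif_neg hp, dif_pos hl]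
      rw [this]
      exact (hIH l hp hl).choose_spec.2.2
  obtain ⟨x₀, hx₀U, hx₀A⟩ := hxA
  have hx₀o : x₀ ≠ o := fun h => hoA (h ▸ hx₀A)
  obtain ⟨l₀, hl₀⟩ := hcover x₀ hx₀U hx₀o
  have hlive₀ : a l₀ ∈ A := halive l₀ ⟨x₀, hl₀, hx₀A⟩
  set tl : Fin d → ℝ := fun l => (prodBernoulli w).real {ω : BondConfig (Fin n) |
    (A.filter fun x => (openGraph (ω ∩ ↑((V l).sym2))).Reachable (a l) x).card ≤ j} with htl
  obtain ⟨i, hi, himax⟩ := Finset.exists_max_image (Finset.univ.filter fun l => a l ∈ A) tl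
    ⟨l₀, Finset.mem_filter.2 ⟨Finset.mem_univ _, hlive₀⟩⟩
  have hiA : a i ∈ A := (Finset.mem_filter.1 hi).2
  refine ⟨a i, hVW i (haV i), hiA, ?_⟩
  exact tform_transfer w A U o j V p a i hoA hpV haV hoV hdisj hoU hVW hcover hobs hsep hdead hT hiA
    (fun l hl => himax l (Finset.mem_filter.2 ⟨Finset.mem_univ _, hl⟩))


/-- **The T-form for a hull tree with free leaves**: if every positive pair at every INTERNAL vertex of the hull
of `o ∉ A` is a bridge of the graph of positive pairs (leaves and everything below relay ports arbitrary), then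
some relay `c` has `μ{1 ≤ N ≤ j} ≤ μ{1 ≤ N ∧ |π(c)| ≤ j}`. [folklore] -/
theorem tform_hullTree (ho : o₀ ∉ A) (hA : A.Nonempty)
    (hH : ∀ v u : Fin n,
      (SimpleGraph.fromRel fun x y : Fin n => x ∉ A ∧ y ∉ A ∧ w s(x, y) ≠ 0).Reachable o₀ v →
      ((v = o₀ ∧ ∃ u', u' ∉ A ∧ (SimpleGraph.fromRel fun x y : Fin n => w s(x, y) ≠ 0).Adj v u') ∨
        (∃ u₁ u₂, u₁ ≠ u₂ ∧ u₁ ∉ A ∧ u₂ ∉ A ∧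
          (SimpleGraph.fromRel fun x y : Fin n => w s(x, y) ≠ 0).Adj v u₁ ∧
          (SimpleGraph.fromRel fun x y : Fin n => w s(x, y) ≠ 0).Adj v u₂)) →
      (SimpleGraph.fromRel fun x y : Fin n => w s(x, y) ≠ 0).Adj v u →
      (SimpleGraph.fromRel fun x y : Fin n => w s(x, y) ≠ 0).IsBridge s(v, u)) :
    ∃ c ∈ A,
      (prodBernoulli w).real {ω : BondConfig (Fin n) |
          1 ≤ (A.filter fun x => ω ∈ openConn o₀ x).card ∧
            (A.filter fun x => ω ∈ openConn o₀ x).card ≤ j} ≤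
        (prodBernoulli w).real {ω : BondConfig (Fin n) |
          1 ≤ (A.filter fun x => ω ∈ openConn o₀ x).card ∧
            (A.filter fun x => ω ∈ openConn c x).card ≤ j} := by
  obtain ⟨x₀, hx₀⟩ := hA
  have hbr : (∃ u ∈ (Finset.univ : Finset (Fin n)), u ∉ A ∧ u ≠ o₀ ∧ w s(o₀, u) ≠ 0) → ∀ u,
      (SimpleGraph.fromRel fun x y : Fin n => w s(x, y) ≠ 0).Adj o₀ u →
      (SimpleGraph.fromRel fun x y : Fin n => w s(x, y) ≠ 0).IsBridge s(o₀, u) := by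
    rintro ⟨u, -, huA, huo, hwu⟩ u' hadj
    refine hH o₀ u' (SimpleGraph.Reachable.refl _) (Or.inl ⟨rfl, u, huA, ?_⟩) hadj
    rw [SimpleGraph.fromRel_adj]
    exact ⟨huo.symm, Or.inl hwu⟩
  obtain ⟨c, -, hcA, h⟩ := tform_hullTree_inside w A j o₀ hH _ Finset.univ rfl o₀
    (Finset.mem_univ o₀) ho (SimpleGraph.Reachable.refl _) hbr ⟨x₀, Finset.mem_univ _, hx₀⟩
  refine ⟨c, hcA, ?_⟩
  have e1 : ∀ (y : Fin n) (ω : BondConfig (Fin n)),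
      (A.filter fun x => (openGraph (ω ∩ ↑((Finset.univ : Finset (Fin n)).sym2))).Reachable y x) =
        (A.filter fun x => ω ∈ openConn y x) := fun y ω =>
    Finset.filter_congr fun x _ => by rw [inter_univ_sym2]; exact Iff.rfl
  simp only [e1] at h
  exact h

end HullTree

end SteinerPorts

end CutObserver

end Summit.CriticalPhenomena.PercolationContinuityZ3.Theorems

end
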